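import Mathlib
import HarnessLib

/-!
# LatticeQCDFlow / Scaling — the one-plaquette Gini constant of the untrained SU(2) sampler:
# `E|cos α − cos α′| = 256/(45π²)` under the class-angle law `(2/π)sin²α dα` (the semicircle law),
# so the one-plaquette strong-coupling slope is `s_1 = 128/(45π²) ≈ 0.2882`

HONEST FRAMING: exact (Metropolis-corrected) sampling algorithms for lattice gauge theory;
figures of merit are autocorrelation/cost numbers at stated couplings and volumes; no
continuum-physics claim.

Venture `LatticeQCDFlow` (cell pub-lqcd), topic `Scaling`; FANOUT row 3 (`s0-u1-a`, S0-B
implementation A, GEN-18).  NEW WORK of the cell (a calculus exercise), not a published result; NO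
definition is introduced; imports Mathlib only.  Companion of `Scaling/CosineGiniConstant` (U(1):
`E|cos θ − cos θ′| = 8/π²`, `s_1 = 4/π²`).  Row 3's `Scaling/SU2IdentityFlowAcceptanceStrongCoupling`
(GEN-17 (O)) reads `(1 − acc_V(β))/β → s_V = ½∫Q∫Q′|Σᵢcos αᵢ − Σᵢcos α′ᵢ|` with `Q = ∏ᵢ(2/π)sin²αᵢ`;
`Scaling/SU2IdentityFlowSlopeVolumeLaw` (GEN-18 (F18)) bounds `√(V/24) ≤ s_V ≤ √(V/12)`.  Here the
ONE-plaquette constant is computed exactly; under the class-angle law `cos α` follows the semicircle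
law on `[−1, 1]`, whose Gini mean difference is `256/(45π²)`; the value `s_1 = 128/(45π²) ≈ 0.28820`
sits just below the Glasser bound `√(1/12) ≈ 0.28868`.

* `intervalIntegral_sin_sq_mul_cos_ab` (`∫_a^b sin²cos = (sin³b − sin³a)/3`);
* `intervalIntegral_abs_cos_sub_cos_mul_sin_sq` — for `a ∈ [0, π]`:
  `∫₀^π |cos a − cos θ| sin²θ dθ = (2/3)sin³a + (π/2 − a)cos a + sin a cos²a`;
* `intervalIntegral_sin_pow_five`, `intervalIntegral_sin_cube_mul_cos_sq`,
  `intervalIntegral_sub_mul_sin_sq_mul_cos` (`16/15`, `4/15`, `4/9`), `intervalIntegral_su2_outer` (`64/45`);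
* **`integral_integral_abs_cos_sub_cos_su2`** — `∫₀^π (2/π)sin²a ∫₀^π (2/π)sin²θ |cos a − cos θ| dθ da
  = 256/(45π²)` (set-integral form over `Ioc 0 π`);
* **`su2IdentityFlow_slope_unique`** — in the exact shape of GEN-17 (O)'s slope with a one-element
  index type: `s_1 = 128/(45π²)`.

[folklore: the mean absolute difference of the semicircle law; no source is relied on.]
-/

noncomputable section

namespace Summit.Ventures.LatticeQCDFlow.Theory2

open MeasureTheory Real Set intervalIntegral

/-- `∫_a^b sin²θ cos θ dθ = (sin³b − sin³a)/3`. [folklore] -/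
theorem intervalIntegral_sin_sq_mul_cos_ab (a b : ℝ) :
    ∫ θ in a..b, Real.sin θ ^ 2 * Real.cos θ = (Real.sin b ^ 3 - Real.sin a ^ 3) / 3 := by
  have h := integral_sin_pow_mul_cos_pow_odd (a := a) (b := b) 2 0
  simp only [mul_zero, zero_add, pow_one, pow_zero, mul_one] at h
  rw [h, integral_pow]
  norm_num

/-- For `a ∈ [0, π]`: **`∫₀^π |cos a − cos θ| sin²θ dθ = (2/3) sin³a + (π/2 − a) cos a + sin a cos²a`**
(split at `θ = a`; `cos` is decreasing on `[0, π]`). [folklore] -/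
theorem intervalIntegral_abs_cos_sub_cos_mul_sin_sq {a : ℝ} (ha0 : 0 ≤ a) (haπ : a ≤ π) :
    ∫ θ in (0 : ℝ)..π, |Real.cos a - Real.cos θ| * Real.sin θ ^ 2
      = 2 / 3 * Real.sin a ^ 3 + (π / 2 - a) * Real.cos a + Real.sin a * Real.cos a ^ 2 := by
  have hcont : Continuous fun θ => |Real.cos a - Real.cos θ| * Real.sin θ ^ 2 :=
    (continuous_const.sub Real.continuous_cos).abs.mul (Real.continuous_sin.pow 2)
  rw [← integral_add_adjacent_intervals (hcont.intervalIntegrable 0 a) (hcont.intervalIntegrable a π)]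
  have h1 : ∫ θ in (0 : ℝ)..a, |Real.cos a - Real.cos θ| * Real.sin θ ^ 2
      = ∫ θ in (0 : ℝ)..a, (Real.sin θ ^ 2 * Real.cos θ - Real.cos a * Real.sin θ ^ 2) := by
    refine integral_congr fun θ hθ => ?_
    rw [uIcc_of_le ha0] at hθ
    have hle : Real.cos a ≤ Real.cos θ := Real.cos_le_cos_of_nonneg_of_le_pi hθ.1 haπ hθ.2
    show |Real.cos a - Real.cos θ| * Real.sin θ ^ 2 = Real.sin θ ^ 2 * Real.cos θ - Real.cos a * Real.sin θ ^ 2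
    rw [abs_of_nonpos (sub_nonpos.2 hle)]
    ring
  have h2 : ∫ θ in a..π, |Real.cos a - Real.cos θ| * Real.sin θ ^ 2
      = ∫ θ in a..π, (Real.cos a * Real.sin θ ^ 2 - Real.sin θ ^ 2 * Real.cos θ) := by
    refine integral_congr fun θ hθ => ?_
    rw [uIcc_of_le haπ] at hθ
    have hle : Real.cos θ ≤ Real.cos a := Real.cos_le_cos_of_nonneg_of_le_pi ha0 hθ.2 hθ.1
    show |Real.cos a - Real.cos θ| * Real.sin θ ^ 2 = Real.cos a * Real.sin θ ^ 2 - Real.sin θ ^ 2 * Real.cos θ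
    rw [abs_of_nonneg (sub_nonneg.2 hle)]
    ring
  have i1 : IntervalIntegrable (fun θ => Real.sin θ ^ 2 * Real.cos θ) volume 0 a :=
    ((Real.continuous_sin.pow 2).mul Real.continuous_cos).intervalIntegrable _ _
  have i2 : IntervalIntegrable (fun θ => Real.cos a * Real.sin θ ^ 2) volume 0 a :=
    (continuous_const.mul (Real.continuous_sin.pow 2)).intervalIntegrable _ _
  have i3 : IntervalIntegrable (fun θ => Real.cos a * Real.sin θ ^ 2) volume a π :=
    (continuous_const.mul (Real.continuous_sin.pow 2)).intervalIntegrable _ _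
  have i4 : IntervalIntegrable (fun θ => Real.sin θ ^ 2 * Real.cos θ) volume a π :=
    ((Real.continuous_sin.pow 2).mul Real.continuous_cos).intervalIntegrable _ _
  rw [h1, h2, intervalIntegral.integral_sub i1 i2, intervalIntegral.integral_sub i3 i4,
    intervalIntegral.integral_const_mul, intervalIntegral.integral_const_mul,
    intervalIntegral_sin_sq_mul_cos_ab, intervalIntegral_sin_sq_mul_cos_ab, integral_sin_sq, integral_sin_sq,
    Real.sin_zero, Real.cos_zero, Real.sin_pi, Real.cos_pi]
  ring

/-- `∫₀^π sin⁵ = 16/15`. [folklore] -/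
theorem intervalIntegral_sin_pow_five : ∫ a in (0 : ℝ)..π, Real.sin a ^ 5 = 16 / 15 := by
  have h := integral_sin_pow_odd 2
  rw [show 2 * 2 + 1 = 5 by norm_num] at h
  rw [h, Finset.prod_range_succ, Finset.prod_range_succ, Finset.prod_range_zero]
  norm_num

/-- `∫₀^π sin³a cos²a da = 4/15`. [folklore] -/
theorem intervalIntegral_sin_cube_mul_cos_sq :
    ∫ a in (0 : ℝ)..π, Real.sin a ^ 3 * Real.cos a ^ 2 = 4 / 15 := by
  have h := integral_sin_pow_odd_mul_cos_pow (a := 0) (b := π) 1 2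
  rw [show 2 * 1 + 1 = 3 by norm_num] at h
  rw [h, Real.cos_zero, Real.cos_pi]
  simp only [pow_one]
  have e : (fun u : ℝ => u ^ 2 * (1 - u ^ 2)) = fun u => u ^ 2 - u ^ 4 := by funext u; ring
  have i1 : IntervalIntegrable (fun u : ℝ => u ^ 2) volume (-1 : ℝ) 1 :=
    (continuous_pow 2).intervalIntegrable _ _
  have i2 : IntervalIntegrable (fun u : ℝ => u ^ 4) volume (-1 : ℝ) 1 :=
    (continuous_pow 4).intervalIntegrable _ _
  rw [e, intervalIntegral.integral_sub i1 i2, integral_pow, integral_pow]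
  norm_num

/-- `d/da (sin³a/3) = sin²a cos a`. [folklore] -/
theorem hasDerivAt_sin_cube_div_three (a : ℝ) :
    HasDerivAt (fun x => Real.sin x ^ 3 / 3) (Real.sin a ^ 2 * Real.cos a) a := by
  have h := ((Real.hasDerivAt_sin a).pow 3).div_const 3
  refine h.congr_deriv ?_
  norm_num
  ring

/-- `∫₀^π (π/2 − a) sin²a cos a da = 4/9` (by parts against `sin³/3`; `∫₀^π sin³ = 4/3`). [folklore] -/
theorem intervalIntegral_sub_mul_sin_sq_mul_cos :
    ∫ a in (0 : ℝ)..π, (π / 2 - a) * (Real.sin a ^ 2 * Real.cos a) = 4 / 9 := by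
  have hu : ∀ x ∈ uIcc (0 : ℝ) π, HasDerivAt (fun x => π / 2 - x) (-1) x := fun x _ => by
    simpa using (hasDerivAt_id x).const_sub (π / 2)
  have hv : ∀ x ∈ uIcc (0 : ℝ) π, HasDerivAt (fun x => Real.sin x ^ 3 / 3) (Real.sin x ^ 2 * Real.cos x) x :=
    fun x _ => hasDerivAt_sin_cube_div_three x
  have h := integral_mul_deriv_eq_deriv_mul hu hv (continuous_const.intervalIntegrable _ _)
    (((Real.continuous_sin.pow 2).mul Real.continuous_cos).intervalIntegrable _ _)
  rw [h, Real.sin_zero, Real.sin_pi]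
  have h3 : ∫ x in (0 : ℝ)..π, Real.sin x ^ 3 = 4 / 3 := by
    have h' := integral_sin_pow_odd 1
    rw [show 2 * 1 + 1 = 3 by norm_num] at h'
    rw [h', Finset.prod_range_succ, Finset.prod_range_zero]
    norm_num
  have e : (fun x : ℝ => -1 * (Real.sin x ^ 3 / 3)) = fun x => -(1 / 3) * Real.sin x ^ 3 := by
    funext x; ring
  rw [e, intervalIntegral.integral_const_mul, h3]
  ring

/-- **The outer integral**: `∫₀^π sin²a·((2/3)sin³a + (π/2 − a)cos a + sin a cos²a) da = 64/45`.
[folklore] -/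
theorem intervalIntegral_su2_outer :
    ∫ a in (0 : ℝ)..π, Real.sin a ^ 2
        * (2 / 3 * Real.sin a ^ 3 + (π / 2 - a) * Real.cos a + Real.sin a * Real.cos a ^ 2) = 64 / 45 := by
  have e : (fun a : ℝ => Real.sin a ^ 2
      * (2 / 3 * Real.sin a ^ 3 + (π / 2 - a) * Real.cos a + Real.sin a * Real.cos a ^ 2))
      = fun a => (2 / 3 * Real.sin a ^ 5 + (π / 2 - a) * (Real.sin a ^ 2 * Real.cos a))
          + Real.sin a ^ 3 * Real.cos a ^ 2 := by
    funext a; ring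
  have i1 : IntervalIntegrable (fun a : ℝ => 2 / 3 * Real.sin a ^ 5) volume 0 π :=
    (continuous_const.mul (Real.continuous_sin.pow 5)).intervalIntegrable _ _
  have i2 : IntervalIntegrable (fun a : ℝ => (π / 2 - a) * (Real.sin a ^ 2 * Real.cos a)) volume 0 π :=
    ((continuous_const.sub continuous_id).mul ((Real.continuous_sin.pow 2).mul Real.continuous_cos)).intervalIntegrable _ _
  have i3 : IntervalIntegrable (fun a : ℝ => Real.sin a ^ 3 * Real.cos a ^ 2) volume 0 π :=
    ((Real.continuous_sin.pow 3).mul (Real.continuous_cos.pow 2)).intervalIntegrable _ _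
  rw [e, intervalIntegral.integral_add (i1.add i2) i3, intervalIntegral.integral_add i1 i2,
    intervalIntegral.integral_const_mul, intervalIntegral_sin_pow_five,
    intervalIntegral_sub_mul_sin_sq_mul_cos, intervalIntegral_sin_cube_mul_cos_sq]
  norm_num

/-- **The weighted double integral** (interval form):
`∫₀^π sin²a (∫₀^π |cos a − cos θ| sin²θ dθ) da = 64/45`. [folklore] -/
theorem intervalIntegral_intervalIntegral_abs_cos_sub_cos_su2 :
    ∫ a in (0 : ℝ)..π, Real.sin a ^ 2 * ∫ θ in (0 : ℝ)..π, |Real.cos a - Real.cos θ| * Real.sin θ ^ 2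
      = 64 / 45 := by
  rw [← intervalIntegral_su2_outer]
  refine integral_congr fun a ha => ?_
  rw [uIcc_of_le Real.pi_pos.le] at ha
  show Real.sin a ^ 2 * ∫ θ in (0 : ℝ)..π, |Real.cos a - Real.cos θ| * Real.sin θ ^ 2
    = Real.sin a ^ 2 * (2 / 3 * Real.sin a ^ 3 + (π / 2 - a) * Real.cos a + Real.sin a * Real.cos a ^ 2)
  rw [intervalIntegral_abs_cos_sub_cos_mul_sin_sq ha.1 ha.2]

/-- **`E|cos α − cos α′| = 256/(45π²)` UNDER THE PRODUCT OF THE ONE-ANGLE CLASS LAWS** (set-integral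
form over `Ioc 0 π`, densities written as factors):
`∫ (2/π)sin²a ∫ (2/π)sin²θ |cos a − cos θ| dθ da = 256/(45π²)` — the Gini mean difference of the
semicircle law. [folklore] -/
theorem integral_integral_abs_cos_sub_cos_su2 :
    ∫ a, 2 / π * Real.sin a ^ 2 * ∫ θ, 2 / π * Real.sin θ ^ 2 * |Real.cos a - Real.cos θ|
        ∂(volume.restrict (Ioc (0 : ℝ) π)) ∂(volume.restrict (Ioc (0 : ℝ) π)) = 256 / (45 * π ^ 2) := by
  have hπ0 : (0 : ℝ) ≤ π := Real.pi_pos.le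
  have hπ : π ≠ 0 := Real.pi_ne_zero
  have inner : ∀ a : ℝ, ∫ θ, 2 / π * Real.sin θ ^ 2 * |Real.cos a - Real.cos θ| ∂(volume.restrict (Ioc (0 : ℝ) π))
      = 2 / π * ∫ θ in (0 : ℝ)..π, |Real.cos a - Real.cos θ| * Real.sin θ ^ 2 := fun a => by
    rw [← intervalIntegral.integral_const_mul, intervalIntegral.integral_of_le hπ0]
    refine integral_congr_ae (ae_of_all _ fun θ => ?_)
    simp only
    ring
  simp_rw [inner]
  rw [show (∫ a, 2 / π * Real.sin a ^ 2 * (2 / π * ∫ θ in (0 : ℝ)..π, |Real.cos a - Real.cos θ| * Real.sin θ ^ 2)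
      ∂(volume.restrict (Ioc (0 : ℝ) π)))
      = ∫ a in Ioc (0 : ℝ) π, (2 / π) ^ 2 * (Real.sin a ^ 2 * ∫ θ in (0 : ℝ)..π,
          |Real.cos a - Real.cos θ| * Real.sin θ ^ 2) from
      integral_congr_ae (ae_of_all _ fun a => by simp only; ring),
    ← intervalIntegral.integral_of_le hπ0, intervalIntegral.integral_const_mul,
    intervalIntegral_intervalIntegral_abs_cos_sub_cos_su2]
  field_simp
  ring

/-- Transfer to the one-element product form of GEN-17 (O)'s slope
(`MeasureTheory.measurePreserving_piUnique`): with `|ι| = 1`,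
`½∫(∏(2/π)sin²)∫(∏(2/π)sin²)|Σcos − Σcos′| = 128/(45π²)`. [folklore] -/
theorem su2IdentityFlow_slope_unique {ι : Type*} [Fintype ι] [Unique ι] :
    1 / 2 * ∫ x, (∏ i : ι, 2 / π * Real.sin (x i) ^ 2)
        * ∫ x', (∏ i : ι, 2 / π * Real.sin (x' i) ^ 2) * |∑ i, Real.cos (x i) - ∑ i, Real.cos (x' i)|
          ∂(Measure.pi fun _ : ι => volume.restrict (Ioc (0 : ℝ) π))
          ∂(Measure.pi fun _ : ι => volume.restrict (Ioc (0 : ℝ) π))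
      = 128 / (45 * π ^ 2) := by
  have hmp := measurePreserving_piUnique (fun _ : ι => volume.restrict (Ioc (0 : ℝ) π))
  simp only [Fintype.prod_unique, Fintype.sum_unique]
  have inner : ∀ a : ℝ, ∫ x', 2 / π * Real.sin (x' default) ^ 2 * |Real.cos a - Real.cos (x' default)|
      ∂(Measure.pi fun _ : ι => volume.restrict (Ioc (0 : ℝ) π))
      = ∫ θ, 2 / π * Real.sin θ ^ 2 * |Real.cos a - Real.cos θ| ∂(volume.restrict (Ioc (0 : ℝ) π)) :=
    fun a => hmp.integral_comp' (fun θ => 2 / π * Real.sin θ ^ 2 * |Real.cos a - Real.cos θ|)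
  simp_rw [inner]
  have houter : ∫ x, 2 / π * Real.sin (x default) ^ 2 * ∫ θ, 2 / π * Real.sin θ ^ 2
      * |Real.cos (x default) - Real.cos θ| ∂(volume.restrict (Ioc (0 : ℝ) π))
      ∂(Measure.pi fun _ : ι => volume.restrict (Ioc (0 : ℝ) π))
      = ∫ a, 2 / π * Real.sin a ^ 2 * ∫ θ, 2 / π * Real.sin θ ^ 2
          * |Real.cos a - Real.cos θ| ∂(volume.restrict (Ioc (0 : ℝ) π)) ∂(volume.restrict (Ioc (0 : ℝ) π)) :=
    hmp.integral_comp' (fun a => 2 / π * Real.sin a ^ 2 * ∫ θ, 2 / π * Real.sin θ ^ 2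
      * |Real.cos a - Real.cos θ| ∂(volume.restrict (Ioc (0 : ℝ) π)))
  rw [houter, integral_integral_abs_cos_sub_cos_su2]
  have hπ : π ≠ 0 := Real.pi_ne_zero
  field_simp
  ring

/-- **The one-plaquette SU(2) value sits inside the two-sided volume law at `V = 1`, within `0.2%`
of its top**: `√(1/24) ≤ 128/(45π²) ≤ √(1/12)` (`0.2041 ≤ 0.2882 ≤ 0.2887`; from `3.14 < π < 3.15`).
[ours] -/
theorem su2_onePlaquette_slope_mem_Icc :
    Real.sqrt (1 / 24) ≤ 128 / (45 * π ^ 2) ∧ 128 / (45 * π ^ 2) ≤ Real.sqrt (1 / 12) := by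
  have hπ := Real.pi_pos
  have h1 := Real.pi_gt_d2
  have h2 := Real.pi_lt_d2
  have hup : π ^ 2 ≤ 3.15 ^ 2 := by nlinarith
  have hlo : 3.14 ^ 2 ≤ π ^ 2 := by nlinarith
  have h4 : 0 ≤ 128 / (45 * π ^ 2) := by positivity
  have hsq : Real.sqrt ((128 / (45 * π ^ 2)) ^ 2) = 128 / (45 * π ^ 2) := Real.sqrt_sq h4
  have hπ4 : (128 / (45 * π ^ 2)) ^ 2 = 16384 / (2025 * (π ^ 2) ^ 2) := by ring
  have hlo4 : 3.14 ^ 2 * 3.14 ^ 2 ≤ π ^ 2 * π ^ 2 :=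
    mul_le_mul hlo hlo (by norm_num) (by positivity)
  have hup4 : π ^ 2 * π ^ 2 ≤ 3.15 ^ 2 * 3.15 ^ 2 :=
    mul_le_mul hup hup (by positivity) (by norm_num)
  constructor
  · rw [← hsq]
    refine Real.sqrt_le_sqrt ?_
    rw [hπ4, div_le_div_iff₀ (by norm_num) (by positivity)]
    nlinarith [hup4]
  · rw [← hsq]
    refine Real.sqrt_le_sqrt ?_
    rw [hπ4, div_le_div_iff₀ (by positivity) (by norm_num)]
    nlinarith [hlo4]

end Summit.Ventures.LatticeQCDFlow.Theory2
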